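import Literature.MathematicalPhysics.KineticTheory.HardSphereBBGKYLiouvilleFlow
import Literature.MathematicalPhysics.KineticTheory.HardSphereEuler
import Mathlib.MeasureTheory.Integral.Prod
import Mathlib.MeasureTheory.Integral.IntervalIntegral.Basic

/-!
# Window functional of line `FirstLemma` (idea `kifer-compactification`) — crux
stmt-AtomisticToContinuum-14135 `AntiMazurCoboundaries.CorrectorPressureDecay`

Registered stub `stub_windowFunctional` of the lead's skeleton (namespace
`Summit.AtomisticToContinuum.HydrodynamicLimit.Theorems.KiferCompactification`), proved verbatim.

WINDOW FUNCTIONAL (concrete, finite `N`): for a hard-sphere flow `Φ` on `𝕋³`, continuous `φ : 𝕋³ → ℝ`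
with `|φ| ≤ 1` and continuous `g : ℝ³ → ℝ` with `|g| ≤ κ`, the fast one-body sum
`F(z) = Σᵢ φ(xᵢ) g((vᵢ − u₀)/√θ)` is measurable and bounded by `κ(N+1)`; its window average written with
the jointly measurable piecewise flow `Ψ_s = good.piecewise (Φ_s) id`
(`Literature.MathematicalPhysics.KineticTheory.measurable_piecewise_flow_torus`),
`A(z) = h⁻¹ ∫₀ʰ F(Ψ_s z) ds`, is measurable (parametric integral of a jointly measurable integrand over
`Ioc 0 h`, `StronglyMeasurable.integral_prod_left'`), bounded by `κ(N+1)`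
(`intervalIntegral.norm_integral_le_of_norm_le_const`), and coincides on the good set with the raw window
functional `h⁻¹ ∫₀ʰ F(Φ_s z) ds` of `KineticFluxLdDecay` (`Set.piecewise_eq_of_mem`).
-/

noncomputable section

open MeasureTheory ProbabilityTheory Set

namespace Summit.AtomisticToContinuum.HydrodynamicLimit.Theorems.KiferCompactification

open Literature.MathematicalPhysics.KineticTheory (T3 V3 hsDiameter localGibbsLaw)
open Literature.Analysis.FluidPDE (HardSphereFlow Config)

open scoped Classical in
/-- **Window functional.** For a hard-sphere flow `Φ` on `𝕋³`, continuous `φ` with `|φ| ≤ 1` and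
continuous `g` with `|g| ≤ κ`: the one-body sum `F(z) = Σᵢ φ(xᵢ) g((√θ)⁻¹ • (vᵢ − u₀))` is measurable and
`|F| ≤ κ(N+1)`; the window average `A(z) = h⁻¹ ∫₀ʰ F(good.piecewise (Φ_s) id z) ds` (`h > 0`) is
measurable, `|A| ≤ κ(N+1)`, and `A z = h⁻¹ ∫₀ʰ F(Φ_s z) ds` for `z ∈ good`. Registered stub
`stub_windowFunctional` of line `FirstLemma` (crux stmt-AtomisticToContinuum-14135). -/
theorem stub_windowFunctional {σ : ℝ} {N : ℕ}
    (Φ : HardSphereFlow (Literature.Analysis.FluidPDE.Torus.geometry (Fin 3)) (hsDiameter σ N) (N + 1))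
    (θ : ℝ) (u₀ : V3) (φ : T3 → ℝ) (g : V3 → ℝ) (κ : ℝ) (hφ : Continuous φ) (hg : Continuous g)
    (hφ1 : ∀ x, |φ x| ≤ 1) (hgκ : ∀ v, |g v| ≤ κ) (h : ℝ) (hh : 0 < h) :
    let F : Config (N + 1) (Fin 3) T3 → ℝ := fun z => ∑ i, φ (z i).1 * g ((Real.sqrt θ)⁻¹ • ((z i).2 - u₀))
    let A : Config (N + 1) (Fin 3) T3 → ℝ := fun z =>
      h⁻¹ * ∫ s in (0 : ℝ)..h, F (Φ.good.piecewise (Φ.flow s) id z)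
    Measurable F ∧ (∀ z, |F z| ≤ κ * (N + 1)) ∧ Measurable A ∧ (∀ z, |A z| ≤ κ * (N + 1)) ∧
      (∀ z ∈ Φ.good, A z = h⁻¹ * ∫ s in (0 : ℝ)..h, F (Φ.flow s z)) := by
  intro F A
  -- measurability of the one-body sum `F`: a finite sum of products of continuous functions of the
  -- (measurable) position / velocity coordinates
  have hF_meas : Measurable F
  · refine Finset.measurable_sum _ fun i _ => ?_
    have h1 : Measurable fun z : Config (N + 1) (Fin 3) T3 => (z i).1
    · exact (measurable_pi_apply i).fst
    have h2 : Measurable fun z : Config (N + 1) (Fin 3) T3 => (z i).2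
    · exact (measurable_pi_apply i).snd
    exact (hφ.measurable.comp h1).mul
      (hg.measurable.comp ((h2.sub_const u₀).const_smul ((Real.sqrt θ)⁻¹)))
  -- each summand is bounded by `1 * κ`
  have hterm : ∀ (z : Config (N + 1) (Fin 3) T3) (i : Fin (N + 1)),
      |φ (z i).1 * g ((Real.sqrt θ)⁻¹ • ((z i).2 - u₀))| ≤ κ
  · intro z i
    rw [abs_mul]
    exact (mul_le_mul (hφ1 _) (hgκ _) (abs_nonneg _) zero_le_one).trans_eq (one_mul κ)
  -- the bound `|F| ≤ κ (N + 1)`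
  have hF_bound : ∀ z, |F z| ≤ κ * (N + 1)
  · intro z
    refine (Finset.abs_sum_le_sum_abs _ _).trans ((Finset.sum_le_sum fun i _ => hterm z i).trans_eq ?_)
    rw [Finset.sum_const, Finset.card_univ, Fintype.card_fin, nsmul_eq_mul]
    push_cast
    ring
  -- joint measurability of the integrand `(s, z) ↦ F (Ψ_s z)`
  have hjoint : Measurable fun p : ℝ × Config (N + 1) (Fin 3) T3 =>
      F (Φ.good.piecewise (Φ.flow p.1) id p.2)
  · exact hF_meas.comp (Literature.MathematicalPhysics.KineticTheory.measurable_piecewise_flow_torus Φ)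
  -- measurability of the parametric integral over `Ioc 0 h`
  have hint : Measurable fun z : Config (N + 1) (Fin 3) T3 =>
      ∫ s in Set.Ioc (0 : ℝ) h, F (Φ.good.piecewise (Φ.flow s) id z)
  · exact (hjoint.stronglyMeasurable.integral_prod_left').measurable
  -- `A` rewritten as a set integral
  have hA_eq : ∀ z, A z = h⁻¹ * ∫ s in Set.Ioc (0 : ℝ) h, F (Φ.good.piecewise (Φ.flow s) id z)
  · intro z
    show h⁻¹ * (∫ s in (0 : ℝ)..h, F (Φ.good.piecewise (Φ.flow s) id z)) = _
    rw [intervalIntegral.integral_of_le hh.le]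
  -- measurability of the window average `A`
  have hA_meas : Measurable A
  · have hA_eq' : A = fun z => h⁻¹ * ∫ s in Set.Ioc (0 : ℝ) h, F (Φ.good.piecewise (Φ.flow s) id z)
    · exact funext hA_eq
    rw [hA_eq']
    exact hint.const_mul _
  -- the bound `|A| ≤ κ (N + 1)`
  have hA_bound : ∀ z, |A z| ≤ κ * (N + 1)
  · intro z
    have hb : ‖∫ s in (0 : ℝ)..h, F (Φ.good.piecewise (Φ.flow s) id z)‖ ≤ κ * (N + 1) * |h - 0|
    · exact intervalIntegral.norm_integral_le_of_norm_le_const fun s _ => by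
        rw [Real.norm_eq_abs]
        exact hF_bound _
    rw [sub_zero, abs_of_pos hh, Real.norm_eq_abs] at hb
    show |h⁻¹ * ∫ s in (0 : ℝ)..h, F (Φ.good.piecewise (Φ.flow s) id z)| ≤ κ * (N + 1)
    rw [abs_mul, abs_of_pos (inv_pos.2 hh)]
    refine (mul_le_mul_of_nonneg_left hb (inv_pos.2 hh).le).trans_eq ?_
    field_simp
  -- the good-set identity: `Ψ_s z = Φ_s z` for `z ∈ good`
  have hA_good : ∀ z ∈ Φ.good, A z = h⁻¹ * ∫ s in (0 : ℝ)..h, F (Φ.flow s z)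
  · intro z hz
    show h⁻¹ * (∫ s in (0 : ℝ)..h, F (Φ.good.piecewise (Φ.flow s) id z)) = _
    congr 1
    refine intervalIntegral.integral_congr fun s _ => ?_
    simp only [Set.piecewise_eq_of_mem _ _ _ hz]
  exact ⟨hF_meas, hF_bound, hA_meas, hA_bound, hA_good⟩

end Summit.AtomisticToContinuum.HydrodynamicLimit.Theorems.KiferCompactification
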